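import Summits.QuantumAdvantage.AdviceFreeQNC0.CodegTwoRows
import Summits.QuantumAdvantage.AdviceFreeQNC0.LiftFromTransversal
import HarnessLib

/-!
# Cell qa-qnc0 (rung F-S1, route RingFrame, crux α, line `tensor`): R1U at co-degree two —
# `LiftOneUCodegTwo : LiftOneUAt 3 2` (qn-p2 ROUND-5 THEOREM E2), via moments and Meshulam

Planner qa-qnc0-p2's ROUND-5 reduces the rung R1U (`LiftOneU`) to its fixed-gap instances
`LiftOneUAt c K` (`L' = d + c`, co-degree `e = c − 1`).  E1 (`c = 2`, `K = 1`) is `CodegOne.lean`.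
This file proves

* **THEOREM E2** `liftOneUCodegTwo : LiftOneUCodegTwo` (`:= LiftOneUAt 3 2`, Sketch5 verbatim):
  at `L' = d + 3`, radius `w ≤ 4`, every matrix `X` with LINEAR columns whose rows are `w`-close to
  `RM(d, d+3)` is `2·(d+2)·w·2^L`-close to a matrix with linear columns and rows in `RM(d, d+3)`.

Proof (ROUND-5 §2.2, the quadratic layer bounded by MESHULAM instead of star/top), `m = d + 3`:
`V = syn2(rows of X)` is a linear space each of whose elements is the syndrome of the LEADER
`X(u,·) ⊕ Y(u,·)` (`≤ w` points) of an actual row (`exists_row_of_mem_V`, `syn2_rowZ`); the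
parity/point-sum map `V → 𝔽₂^{1+m}` has kernel of dimension `≤ 2m` (`finrank_ker_le`: such a leader
is empty or a zero-sum quadruple, its moment matrix has rank `≤ 2`, and the moment matrix is
injective on the kernel — `Syndrome2.finrank_le_two_mul`; the kernel is `0` if `w ≤ 3`), so
`dim V ≤ 3m + 1` (`finrank_V_le`).  A basis of `V`, one realising leader per basis syndrome (`ldr`),
extended linearly (`rep = Basis.constr`): every row `X(u,·)` has the representative `rep (syn2 X(u,·))`
of its coset mod `RM(d, d+3)` (`syn2_rep`), supported on the TRANSVERSAL `Z = ⋃ leaders`,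
`#Z ≤ w·dim V` (`card_Z_le`); the lift with linear columns and `hw(X ⊕ W) ≤ 2^{L−1}·#Z` is then the
literature seat's `exists_lift_of_transversal` (`LiftFromTransversal.lean`), and
`2^{L−1}·4(d+2)w = 2(d+2)·w·2^L` (`d ≤ 1`: `#Z ≤ 2^m ≤ 16`; `w ≤ 3`: `#Z ≤ w(m+1)`).

The cell's theorem (planner qa-qnc0-p2 gen 5 ROUND-5 §2.2 / ask R5-a in its ladder form; prover
qa-qnc0-prover gen 6, 2026-08-27).  WHAT THIS IS NOT: not the sharper `CostBoundCodegTwo`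
(`cov ≤ 6m + 4`, constant `3d + 11`; needs the STAR/TOP transversal `2m` for the quadratic layer —
Meshulam only gives `dim ≤ 2m`, transversal `≤ 8m`); nothing on co-degree `≥ 3`, `LiftOneU`, α or the
separation.

## References

* R. Meshulam, *On the maximal rank in a subspace of matrices*, Quart. J. Math. Oxford 36 (1985)
  225–229, Thm 2 [Meshulam1985] (through `Syndrome2.finrank_le_two_mul`).
-/

noncomputable section

namespace Summit.QuantumAdvantage.AdviceFreeQNC0

open Finset Module
open Literature.Computability.MetaComplexity Literature.Computability.MetaComplexity.Smolensky
open MeanLoad Syndrome2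

/-- **THEOREM E2** (qn-p2 ROUND-5 §2.2, `Sketch5.LiftOneUCodegTwo` verbatim; co-degree 2, `f = 8`,
radius `4`): constant `K = 2`. -/
def LiftOneUCodegTwo : Prop := LiftOneUAt 3 2

namespace CodegTwo

variable {L d : ℕ} {X Y : BMat L (d + 3)} {w : ℕ}

/-! ### The transversal -/

section Transversal

variable (X Y) (hX : LinCols X)

/-- a basis of the row-syndrome space. -/
def bV : Basis (Fin (finrank (ZMod 2) (V X))) (ZMod 2) (V X) := Module.finBasis (ZMod 2) (V X)

/-- a row realising the `i`-th basis syndrome. -/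
def pick (i : Fin (finrank (ZMod 2) (V X))) : Fin L → Bool :=
  Classical.choose (exists_row_of_mem_V hX (bV X i).2)

/-- `pick` realises the basis syndrome. -/
theorem syn2_pick (i : Fin (finrank (ZMod 2) (V X))) : syn2 (rowZ X (pick X hX i)) = (bV X i : _) :=
  Classical.choose_spec (exists_row_of_mem_V hX (bV X i).2)

/-- the leader attached to the `i`-th basis syndrome (as an `𝔽₂`-word). -/
def ldr (i : Fin (finrank (ZMod 2) (V X))) : CubeFn (ZMod 2) (d + 3) := indF (leader X Y (pick X hX i))

/-- **The linear representative map**: the basis syndrome `b_i` gets its leader, extended linearly. -/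
def rep : V X →ₗ[ZMod 2] CubeFn (ZMod 2) (d + 3) := (bV X).constr (ZMod 2) (ldr X Y hX)

/-- `rep s` has syndrome `s`. -/
theorem syn2_rep (hY : RowsDeg d Y) (s : V X) : syn2 (rep X Y hX s) = (s : _) := by
  have h : syn2.comp (rep X Y hX) = (V X).subtype := by
    refine (bV X).ext fun i => ?_
    rw [LinearMap.comp_apply, Submodule.subtype_apply]
    unfold rep
    rw [Basis.constr_basis]
    unfold ldr
    rw [← syn2_rowZ hY, syn2_pick]
  exact LinearMap.congr_fun h s

/-- **The transversal**: the union of the chosen leaders. -/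
def Z : Finset (Fin (d + 3) → Bool) := univ.biUnion fun i => leader X Y (pick X hX i)

/-- `rep s` is supported on `Z`. -/
theorem rep_apply_eq_zero (s : V X) {v : Fin (d + 3) → Bool} (hv : v ∉ Z X Y hX) : rep X Y hX s v = 0 := by
  unfold rep
  rw [Basis.constr_apply_fintype, Finset.sum_apply]
  refine Finset.sum_eq_zero fun i _ => ?_
  have hvi : v ∉ leader X Y (pick X hX i) := fun h =>
    hv (Finset.mem_biUnion.2 ⟨i, Finset.mem_univ _, h⟩)
  simp [ldr, indF, hvi]

/-- **`#Z ≤ w · dim V`.** -/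
theorem card_Z_le (hdist : ∀ u, rowDist X Y u ≤ w) : (Z X Y hX).card ≤ w * finrank (ZMod 2) (V X) := by
  unfold Z
  refine (Finset.card_biUnion_le).trans ?_
  calc ∑ i : Fin (finrank (ZMod 2) (V X)), (leader X Y (pick X hX i)).card
      ≤ ∑ _i : Fin (finrank (ZMod 2) (V X)), w :=
        Finset.sum_le_sum fun i _ => by rw [card_leader]; exact hdist _
    _ = w * finrank (ZMod 2) (V X) := by
        rw [Finset.sum_const, Finset.card_univ, Fintype.card_fin, smul_eq_mul, mul_comm]

/-- `#Z ≤ 2^m` (trivially). -/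
theorem card_Z_le_pow : (Z X Y hX).card ≤ 2 ^ (d + 3) :=
  (Finset.card_le_univ _).trans (by rw [Fintype.card_fun, Fintype.card_bool, Fintype.card_fin])

/-- **Every row has a `Z`-supported representative of its coset mod `RM(d, d+3)`** (the hypothesis
of `exists_lift_of_transversal`). -/
theorem exists_rep (hY : RowsDeg d Y) (u : Fin L → Bool) :
    ∃ v : (Fin (d + 3) → Bool) → Bool, (∀ p, v p = true → p ∈ Z X Y hX) ∧
      HasDeg (fun p => xor (X u p) (v p)) d := by
  set s : V X := ⟨syn2 (rowZ X u), syn2_rowZ_mem X u⟩ with hs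
  refine ⟨fun p => decide (rep X Y hX s p = 1), fun p hp => ?_, ?_⟩
  · by_contra hZ
    have hp' : decide (rep X Y hX s p = 1) = true := hp
    rw [rep_apply_eq_zero X Y hX s hZ] at hp'
    exact absurd hp' (by decide)
  · show (fun p => if xor (X u p) (decide (rep X Y hX s p = 1)) = true then (1 : ZMod 2) else 0) ∈
      lowDeg (ZMod 2) (d + 3) d
    have h : (fun p => if xor (X u p) (decide (rep X Y hX s p = 1)) = true then (1 : ZMod 2) else 0) =
        rowZ X u + rep X Y hX s := by
      funext p
      rw [ind_xor, LiftFromTransversal.zmod2_ind_decide]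
      rfl
    rw [h, ← ker_syn2_eq_lowDeg d, LinearMap.mem_ker, map_add, syn2_rep X Y hX hY]
    funext J
    exact CharTwo.add_self_eq_zero _

end Transversal

end CodegTwo

/-! ### THEOREM E2 -/

/-- **THEOREM E2: `liftOneUCodegTwo : LiftOneUCodegTwo`** (R1U at co-degree two, constant `K = 2`).
[cite: Meshulam1985, Thm 2] -/
theorem liftOneUCodegTwo : LiftOneUCodegTwo := by
  intro L d w hw2 X Y hX hY hdist
  have hw4 : w ≤ 4 := by
    have : (2 : ℕ) ^ 3 = 8 := by norm_num
    omega
  rcases Nat.eq_zero_or_pos w with rfl | hwpos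
  · -- `w = 0`: the rows of `X` are those of `Y`; `W = X`
    refine ⟨X, hX, fun u => ?_, ?_⟩
    · have e : X u = Y u := row_eq_of_rowDist_eq_zero (Nat.le_zero.1 (hdist u))
      have hYu := hY u
      rw [← e] at hYu
      exact hYu
    · rw [hw_xorM_self]
      simp
  rcases Nat.eq_zero_or_pos L with rfl | hLpos
  · -- `L = 0`: the only row index is `0`, where `X` vanishes; `W = X`
    refine ⟨X, hX, fun u => ?_, ?_⟩
    · have hu : u = fun _ => false := funext fun i => Fin.elim0 i
      subst hu
      show (fun v => if X (fun _ => false) v = true then (1 : ZMod 2) else 0) ∈ lowDeg (ZMod 2) (d + 3) d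
      have h : (fun v => if X (fun _ => false) v = true then (1 : ZMod 2) else 0) = 0 :=
        funext fun v => by rw [hX.2 v]; rfl
      rw [h]
      exact Submodule.zero_mem _
    · rw [hw_xorM_self, Nat.cast_zero]
      positivity
  -- main case: the Meshulam transversal and the linear lift
  obtain ⟨W, hW, hWd, hcost⟩ :=
    exists_lift_of_transversal (CodegTwo.Z X Y hX) hX (CodegTwo.exists_rep X Y hX hY)
  refine ⟨W, hW, hWd, ?_⟩
  have hpow : 2 ^ L = 2 * 2 ^ (L - 1) := by
    rw [← Nat.pow_succ']; congr 1; omega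
  -- `#Z ≤ 4 (d+2) w` in all cases
  have hZ : (CodegTwo.Z X Y hX).card ≤ 4 * (d + 2) * w := by
    have hV := CodegTwo.finrank_V_le hX hY hdist hw4
    have hZw := CodegTwo.card_Z_le X Y hX hdist
    by_cases hw3 : w ≤ 3
    · rw [if_pos hw3] at hV
      calc (CodegTwo.Z X Y hX).card ≤ w * finrank (ZMod 2) (CodegTwo.V X) := hZw
        _ ≤ w * (d + 3 + 1) := Nat.mul_le_mul_left _ (by omega)
        _ ≤ 4 * (d + 2) * w := by nlinarith
    · rw [if_neg hw3] at hV
      have hw : w = 4 := by omega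
      subst hw
      by_cases hd : 2 ≤ d
      · calc (CodegTwo.Z X Y hX).card ≤ 4 * finrank (ZMod 2) (CodegTwo.V X) := hZw
          _ ≤ 4 * (d + 3 + 1 + 2 * (d + 3)) := Nat.mul_le_mul_left _ hV
          _ ≤ 4 * (d + 2) * 4 := by nlinarith
      · have hsmall := CodegTwo.card_Z_le_pow X Y hX
        have h16 : 2 ^ (d + 3) ≤ 16 := by
          calc 2 ^ (d + 3) ≤ 2 ^ 4 := Nat.pow_le_pow_right (by norm_num) (by omega)
            _ = 16 := by norm_num
        omega
  have hnat : hw (xorM X W) ≤ 2 * (d + 2) * w * 2 ^ L := by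
    refine hcost.trans ?_
    rw [hpow]
    calc 2 ^ (L - 1) * (CodegTwo.Z X Y hX).card ≤ 2 ^ (L - 1) * (4 * (d + 2) * w) :=
          Nat.mul_le_mul_left _ hZ
      _ = 2 * (d + 2) * w * (2 * 2 ^ (L - 1)) := by ring
  have hR : ((hw (xorM X W) : ℕ) : ℝ) ≤ ((2 * (d + 2) * w * 2 ^ L : ℕ) : ℝ) := by
    exact_mod_cast hnat
  refine hR.trans (le_of_eq ?_)
  push_cast
  ring

end Summit.QuantumAdvantage.AdviceFreeQNC0

end
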